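import Literature.MathematicalPhysics.QuantumFieldTheory.Balaban1983to89.B9RWSums344Input

/-!
# `Balaban1983to89.B9RWSumsReadsRel` — the (3.43)–(3.46) CO-READING SCHEMAS OF THE RANDOM-WALK SUMS RE-TYPED RELATIVE TO A BLOCK
# EQUIVALENCE ON THE SITES (`L2ReadsRel`, `H1ReadsRel`, `InputReadsRel`), and their three engines with the class multiplicity in the
# constant

T. Bałaban, *Propagators for lattice gauge theories in a background field*, Commun. Math. Phys. **99** (1985) 389–434
[`Balaban1985BackgroundPropagators`, "B9"], Thm 3.1 ∕ 3.3 (3.42)–(3.47) pp. 397–399: *"|A| = max_μ sup_x |A_μ(x)|"* (3.39),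
the block quantities *"for x ∈ Δ(y), supp λ ⊂ Δ(y′)"* (3.42), the Hölder members (3.43)–(3.45) and the L² members (3.46);
T. Bałaban, *Propagators and renormalization transformations for lattice gauge theories. II*, Commun. Math. Phys. **96** (1984) 223–250
[`Balaban1984PropagatorsII`], (2.51)–(2.52) p. 232 (*"λ = Σ_{y′} Δ(y′)λ"*, the majorant piece by piece).

statement-level skeleton of published theorems with citation tags; proofs where landed; nothing here is a claim about the
Yang–Mills mass gap

WHY THIS FILE (owner's repair of the rows-18∕19 reading layer).  The co-reading schemas of this lineage — `B9RWSums346Schur.L2Reads`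
((3.46)), `B9RWSums343Holder.H1Reads` ((3.43)), `B9RWSums344Input.InputReads` ((3.44)∕(3.45)) — carry, like n06-c's `B9Thm37GlueCor36.CoRealizes`,
the ONE-FIBRE localisation *"supp λ ⊂ Δ(y′) ⇒ the model evaluation of λ vanishes off the fibre of the SITE y′"* and read the bounded
quantity on the ONE fibre of the site y.  At def-Y's instance of record the sites are INDEX BONDS and several index bonds share one
carrier block Δ; a λ supported in a shared block is then killed by `off` at two distinct bonds, and `obs` bounds a positive quantity by 0:
the schemas are UNSATISFIABLE there (n06-l g3 `B9CoRealizesSharedBlock.not_hcoGA_opsYOfRecord`; referee dag-ref-A READ-18: *"A4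
FAIL-AS-TYPED … `L2Reads∕H1Reads∕InputReads` carry the same one-fibre `off` field"*).  The repair (n06-l's `B9CoRealizesRel.CoRealizesRel`
pattern, mirrored here field for field): every fibre condition is taken RELATIVE TO AN EQUIVALENCE `Rel` on `g.Site` (*"same carrier
block"* at the record; `Rel := Eq` recovers the landed schemas — `l2ReadsRel_eq_iff`, `h1ReadsRel_eq_iff`, `inputReadsRel_eq_iff`):
`off` — supp λ ⊂ Δ(y′) ⇒ the evaluation vanishes at the model points x′ with `¬ Rel (bv x′) y′`; the observed side reads the UNION of
the fibres of the class of y (sup ∕ probe lines: every model point ∕ probe whose site is `Rel`-related to y; L² lines: the SUM of the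
fibre-L² sizes over the class of y, which the instance proves by Minkowski).  The price in the engines is the MULTIPLICITY m of a class
(≦ 2(d+1) index bonds per carrier block at the record) and the SATURATION of the printed majorants on classes, stated geometrically
ONCE (`Rel a a′ ⇒ Lʲ⁽ᵃ⁾η = Lʲ⁽ᵃ′⁾η`, `d(a, b) = d(a′, b)`, `d(b, a) = d(b, a′)`):

* §1 the two cores: ★ `abs_le_of_hasMajorantHom_rel` (a [4]-(2.51) two-lattice majorant, class-saturated, + a function living on the
  class fibres of y′ and bounded by N ⇒ |(A f)(x)| ≦ m·K′(y, y′)·N at every model point x of the class of y — n06-l's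
  `le_of_hasMajorantHom_of_coRealizesRel` with the `obs` call factored out), a private Minkowski helper for the block-L² size
  over a finite sum, ★ `bl2_classSum_le_of_blockBd_rel` (the L² analogue: a block bound ⇒ the class sum of the fibre-L² sizes of T f is
  ≦ m·m·K′(y, y′)·N).
* §2 the schemas ★ `L2ReadsRel`, ★ `H1ReadsRel`, ★ `InputReadsRel` and the `Rel := Eq` bookkeeping.
* §3 the engines, conclusions LITERALLY the member lines AS TYPED with the multiplicity in the constant: ★ `l2line_of_blockBd_rel`
  (constant m·m·B′), ★ `line343_of_hasMajorantHom_rel` (constant m·B(β)), ★ `lines3445_of_hasMaj_rel` (constants unchanged — the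
  input block norm `bH ε` is a LETTER with its own localisation; only `obs4`∕`obs5` are re-sited).

HONEST SCOPE.  Hypothesis schemas of definitional shape and kernel bookkeeping; nothing of [B9] or [4] is asserted; the record-level
instance (`Rel` := same carrier block, `m`, the saturation facts, domination) is the instance seat's.  NOT a node discharge; count-neutral;
one finite 𝕋^{d+1} programme at fixed ε — nothing continuum, nothing about the mass gap.  Cell `pub-ymgap` (HUMAN RULING D-0062), Track A
node N06 [B9], N06-ASSIGNMENT v1 bundle F6 (rows 18–19), seat `pub-ymgap-dag-n06-k` (gen 5), 2026-08-27.
-/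

noncomputable section

namespace Literature.MathematicalPhysics.QuantumFieldTheory.Balaban1983to89.B9RWSumsReadsRel

open Literature.MathematicalPhysics.QuantumFieldTheory.Balaban1983to89
open Finset B6RandomWalk B6RandomWalkHom B9Thm34Ext B9RWSums343to347Whole B9RWSums346Schur B9RWSums343Holder
open B9RWSums344Input B9Thm37GlueCor36 B9SectDL2Decay B11SectG B9Thm37AllNorms B9Thm37AllNormsInstances

/-! ## §1 The two cores: a class-saturated majorant read on the class fibres, sup and L² -/

section Cores

variable {g : B9.Geometry} [Fintype g.Site] [DecidableEq g.Site] {R : ℝ} {H : Prop}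
variable {u v : Type}

/-- ★ **[4]-(2.51) MAJORANT READ RELATIVE TO A BLOCK EQUIVALENCE, SUP FORM** (n06-l's `le_of_hasMajorantHom_of_coRealizesRel` with the
reading's `obs` factored out).  If A has the two-lattice majorant K′ ≧ 0 between the fibres of `bv`, `bu`, K′ is saturated for `Rel` in
both arguments, every class has at most m members, and f lives on the fibres of the class of y′ with |f| ≦ N, then |(A f)(x)| ≦
m·K′(y, y′)·N at every model point x whose site is in the class of y — *"λ = Σ_{y″} Δ(y″)λ"* ([4] (2.52)), the pieces outside the class
vanish, the majorant piece by piece, saturation, the class count.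
[cite: Balaban1985BackgroundPropagators, (3.42) p.397; Balaban1984PropagatorsII, (2.51)–(2.52) p.232] -/
theorem abs_le_of_hasMajorantHom_rel {Rel : g.Site → g.Site → Prop} [DecidableRel Rel] {bu : u → g.Site} {bv : v → g.Site}
    {A : (v → ℝ) →ₗ[ℝ] (u → ℝ)} {K' : g.Site → g.Site → ℝ} (hK' : ∀ a b, 0 ≤ K' a b)
    (hsat₁ : ∀ a a' b, Rel a a' → K' a b = K' a' b) (hsat₂ : ∀ a b b', Rel b b' → K' a b = K' a b')
    {m : ℕ} (hmult : ∀ y' : g.Site, (Finset.univ.filter (fun y'' => Rel y'' y')).card ≤ m)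
    (hA : HasMajorantHom (g := toB6 g R H) bv bu A K') {f : v → ℝ} {N : ℝ} (hN : 0 ≤ N) (hbd : ∀ x', |f x'| ≤ N)
    {y' : g.Site} (hoff : ∀ x', ¬ Rel (bv x') y' → f x' = 0) {y : g.Site} {x : u} (hx : Rel (bu x) y) :
    |A f x| ≤ m * K' y y' * N := by
  -- adapted from n06-l's `B9CoRealizesRel.le_of_hasMajorantHom_of_coRealizesRel`
  classical
  have hKN : 0 ≤ K' y y' * N := mul_nonneg (hK' y y') hN
  have hdec : f = ∑ y'' : (toB6 g R H).Site, blockPiece (g := toB6 g R H) bv y'' f :=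
    (sum_blockPiece (g := toB6 g R H) bv f).symm
  have hzero : ∀ y'' : g.Site, ¬ Rel y'' y' → blockPiece (g := toB6 g R H) bv y'' f = 0 := by
    intro y'' hy''
    funext x'
    by_cases hx' : bv x' = y''
    · simp only [blockPiece, hx', if_true, Pi.zero_apply]
      exact hoff x' (by rw [hx']; exact hy'')
    · simp only [blockPiece, Pi.zero_apply]
      split_ifs with h
      · exact absurd h hx'
      · rfl
  have hpiece : ∀ y'' : g.Site, BlockSupp (g := toB6 g R H) bv (blockPiece (g := toB6 g R H) bv y'' f) y'' N := fun y'' =>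
    { nonneg := hN
      bound := fun z hz => by
        simp only [blockPiece, hz, if_true]
        exact hbd z
      off := fun z hz => by simp only [blockPiece, hz, if_false] }
  have hterm : ∀ y'' : g.Site, |A (blockPiece (g := toB6 g R H) bv y'' f) x| ≤ if Rel y'' y' then K' y y' * N else 0 := by
    intro y''
    by_cases hr : Rel y'' y'
    · rw [if_pos hr]
      have h1 := hA y'' _ N (hpiece y'') x
      rw [hsat₁ _ _ _ hx, hsat₂ _ _ _ hr] at h1
      exact h1
    · rw [if_neg hr, hzero y'' hr, map_zero, Pi.zero_apply, abs_zero]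
  have hAf : A f = ∑ y'' : (toB6 g R H).Site, A (blockPiece (g := toB6 g R H) bv y'' f) := by
    conv_lhs => rw [hdec]
    rw [map_sum]
  calc |A f x| = |∑ y'' : (toB6 g R H).Site, A (blockPiece (g := toB6 g R H) bv y'' f) x| := by rw [hAf, Finset.sum_apply]
    _ ≤ ∑ y'' : (toB6 g R H).Site, |A (blockPiece (g := toB6 g R H) bv y'' f) x| := Finset.abs_sum_le_sum_abs _ _
    _ ≤ ∑ y'' : g.Site, (if Rel y'' y' then K' y y' * N else 0) := Finset.sum_le_sum fun y'' _ => hterm y''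
    _ = ((Finset.univ.filter (fun y'' => Rel y'' y')).card : ℝ) * (K' y y' * N) := by
        rw [Finset.sum_ite, Finset.sum_const_zero, add_zero, Finset.sum_const, nsmul_eq_mul]
    _ ≤ (m : ℝ) * (K' y y' * N) := mul_le_mul_of_nonneg_right (by exact_mod_cast hmult y') hKN
    _ = m * K' y y' * N := by ring

omit [DecidableEq g.Site] in
/-- Minkowski for the block-L² size over a finite sum: ‖1_{Δ(y)} Σ_i f_i‖₂ ≦ Σ_i ‖1_{Δ(y)} f_i‖₂ (`bl2_add_le` iterated). [folklore] -/
private theorem bl2_finset_sum_le {X ι : Type} [Fintype X] (blk : X → (toB6 g R H).Site) (y : g.Site) (s : Finset ι)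
    (F : ι → X → ℝ) :
    bl2 (g := toB6 g R H) blk y (∑ i ∈ s, F i) ≤ ∑ i ∈ s, bl2 (g := toB6 g R H) blk y (F i) := by
  classical
  refine Finset.induction_on s ?_ ?_
  · simp
  · intro a s ha ih
    rw [Finset.sum_insert ha, Finset.sum_insert ha]
    exact (bl2_add_le (g := toB6 g R H) blk y _ _).trans (by linarith)

/-- ★ **[4]-(2.51) MAJORANT READ RELATIVE TO A BLOCK EQUIVALENCE, L² FORM.**  If T has the block bound K′ ≧ 0 (`BlockBd`) between the
fibres of `bv`, `bu`, K′ is saturated for `Rel` in both arguments, every class has at most m members, and f lives on the fibres of the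
class of y′ with every fibre-L² size there ≦ N, then the SUM over the class of y of the fibre-L² sizes of T f is ≦ m·m·K′(y, y′)·N
(the pieces of f by [4] (2.52), Minkowski on each target fibre, the block bound piece by piece, saturation, the class count twice).
[cite: Balaban1985BackgroundPropagators, (3.46) p.398; Balaban1984PropagatorsII, (2.51)–(2.52) p.232] -/
theorem bl2_classSum_le_of_blockBd_rel [Fintype u] [Fintype v] {Rel : g.Site → g.Site → Prop} [DecidableRel Rel]
    {bu : u → g.Site} {bv : v → g.Site} {T : (v → ℝ) →ₗ[ℝ] (u → ℝ)} {K' : g.Site → g.Site → ℝ} (hK' : ∀ a b, 0 ≤ K' a b)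
    (hsat₁ : ∀ a a' b, Rel a a' → K' a b = K' a' b) (hsat₂ : ∀ a b b', Rel b b' → K' a b = K' a b')
    {m : ℕ} (hmult : ∀ y' : g.Site, (Finset.univ.filter (fun y'' => Rel y'' y')).card ≤ m)
    (hT : BlockBd (g := toB6 g R H) bv bu T K') {f : v → ℝ} {N : ℝ} (hN : 0 ≤ N) {y' : g.Site}
    (hl2 : ∀ y'', Rel y'' y' → bl2 (g := toB6 g R H) bv y'' f ≤ N) (hoff : ∀ x', ¬ Rel (bv x') y' → f x' = 0) (y : g.Site) :
    ∑ y'' ∈ Finset.univ.filter (fun y'' => Rel y'' y), bl2 (g := toB6 g R H) bu y'' (T f) ≤ m * (m * K' y y') * N := by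
  classical
  have hKN : 0 ≤ K' y y' * N := mul_nonneg (hK' y y') hN
  have hdec : f = ∑ z : (toB6 g R H).Site, blockPiece (g := toB6 g R H) bv z f :=
    (sum_blockPiece (g := toB6 g R H) bv f).symm
  have hzero : ∀ z : g.Site, ¬ Rel z y' → blockPiece (g := toB6 g R H) bv z f = 0 := by
    intro z hz
    funext x'
    by_cases hx' : bv x' = z
    · simp only [blockPiece, hx', if_true, Pi.zero_apply]
      exact hoff x' (by rw [hx']; exact hz)
    · simp only [blockPiece, Pi.zero_apply]
      split_ifs with h
      · exact absurd h hx'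
      · rfl
  have hTf : T f = ∑ z : (toB6 g R H).Site, T (blockPiece (g := toB6 g R H) bv z f) := by
    conv_lhs => rw [hdec]
    rw [map_sum]
  -- one target fibre of the class of y
  have hfib : ∀ y'' : g.Site, Rel y'' y → bl2 (g := toB6 g R H) bu y'' (T f) ≤ m * (K' y y' * N) := by
    intro y'' hy''
    have hterm : ∀ z : g.Site,
        bl2 (g := toB6 g R H) bu y'' (T (blockPiece (g := toB6 g R H) bv z f)) ≤ if Rel z y' then K' y y' * N else 0 := by
      intro z
      by_cases hr : Rel z y'
      · rw [if_pos hr]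
        have hb := hT z (blockPiece (g := toB6 g R H) bv z f)
          (fun x hx => by simp only [blockPiece, hx, if_false]) y''
        rw [bl2_blockPiece_self, hsat₁ _ _ _ hy'', hsat₂ _ _ _ hr] at hb
        exact hb.trans (mul_le_mul_of_nonneg_left (hl2 z hr) (hK' y y'))
      · rw [if_neg hr, hzero z hr, map_zero, bl2_zero]
    calc bl2 (g := toB6 g R H) bu y'' (T f)
        = bl2 (g := toB6 g R H) bu y'' (∑ z : (toB6 g R H).Site, T (blockPiece (g := toB6 g R H) bv z f)) := by rw [hTf]
      _ ≤ ∑ z : (toB6 g R H).Site, bl2 (g := toB6 g R H) bu y'' (T (blockPiece (g := toB6 g R H) bv z f)) :=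
          bl2_finset_sum_le bu y'' _ _
      _ ≤ ∑ z : g.Site, (if Rel z y' then K' y y' * N else 0) := Finset.sum_le_sum fun z _ => hterm z
      _ = ((Finset.univ.filter (fun z => Rel z y')).card : ℝ) * (K' y y' * N) := by
          rw [Finset.sum_ite, Finset.sum_const_zero, add_zero, Finset.sum_const, nsmul_eq_mul]
      _ ≤ (m : ℝ) * (K' y y' * N) := mul_le_mul_of_nonneg_right (by exact_mod_cast hmult y') hKN
  -- the class of y
  have hm0 : 0 ≤ (m : ℝ) * (K' y y' * N) := mul_nonneg (Nat.cast_nonneg m) hKN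
  calc ∑ y'' ∈ Finset.univ.filter (fun y'' => Rel y'' y), bl2 (g := toB6 g R H) bu y'' (T f)
      ≤ ∑ y'' ∈ Finset.univ.filter (fun y'' => Rel y'' y), (m : ℝ) * (K' y y' * N) :=
        Finset.sum_le_sum fun y'' h => hfib y'' (Finset.mem_filter.1 h).2
    _ = ((Finset.univ.filter (fun y'' => Rel y'' y)).card : ℝ) * ((m : ℝ) * (K' y y' * N)) := by
        rw [Finset.sum_const, nsmul_eq_mul]
    _ ≤ (m : ℝ) * ((m : ℝ) * (K' y y' * N)) := mul_le_mul_of_nonneg_right (by exact_mod_cast hmult y) hm0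
    _ = m * (m * K' y y') * N := by ring

end Cores

/-! ## §2 The three co-reading schemas relative to a block equivalence -/

section Schemas

variable {g : B9.Geometry} [Fintype g.Site] {R : ℝ} {H : Prop} {B : B9.Backgrounds}

/-- ★ **CO-READING OF THE n-TH L² QUANTITY (3.46) OF A KERNEL FAMILY BY A MODEL OPERATOR, RELATIVE TO A BLOCK EQUIVALENCE `Rel` ON THE
SITES** (the repaired form of `B9RWSums346Schur.L2Reads`; `Rel := Eq` recovers it).  Print, (3.46) p. 398: the bounded quantity is ‖h·(Tλ)‖
with supp h ⊂ Δ(y), against |h|·‖λ‖, supp λ ⊂ Δ(y′).  Typed: `off` — supp λ ⊂ Δ(y′) ⇒ `ev λ` vanishes at the model points x′ with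
`¬ Rel (bv x′) y′`; `l2bound` — every fibre-L² size of `ev λ` over the class of y′ is ≦ ‖λ‖; `obs` — `K.l2 n U λ h` is BELOW every c ≧ 0
with (Σ over the class of y of the fibre-L² sizes of T(ev λ))·|h| ≦ c whenever supp h ⊂ Δ(y) (‖h·f‖₂ ≦ |h|·Σ_{y″ ~ y}‖1_{fibre y″}f‖₂ by
Minkowski when the class fibres cover Δ(y)).  OURS (typing): a hypothesis schema on how a model instantiates `l2Norm` ∕ `cutSup` ∕
`KernelFamily.l2` when several sites share one block; nothing is asserted. [cite: Balaban1985BackgroundPropagators, (3.46) p.398] -/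
structure L2ReadsRel {u v : Type} [Fintype u] [Fintype v] (K : B9.KernelFamily g B) (n : Fin 6) (U : B.Cfg)
    (Rel : g.Site → g.Site → Prop) [DecidableRel Rel] (bu : u → g.Site) (bv : v → g.Site) (ev : g.Loc → v → ℝ)
    (T : (v → ℝ) →ₗ[ℝ] (u → ℝ)) : Prop where
  off : ∀ (lam : g.Loc) (y' : g.Site), g.suppIn lam y' → ∀ x', ¬ Rel (bv x') y' → ev lam x' = 0
  l2bound : ∀ (lam : g.Loc) (y' y'' : g.Site), g.suppIn lam y' → Rel y'' y' →
    bl2 (g := toB6 g R H) bv y'' (ev lam) ≤ g.l2Norm lam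
  l2norm_nonneg : ∀ lam : g.Loc, 0 ≤ g.l2Norm lam
  cutSup_nonneg : ∀ h : g.Cut, 0 ≤ g.cutSup h
  obs : ∀ (lam : g.Loc) (h : g.Cut) (y : g.Site) (c : ℝ), 0 ≤ c → g.cutIn h y →
    (∑ y'' ∈ Finset.univ.filter (fun y'' => Rel y'' y), bl2 (g := toB6 g R H) bu y'' (T (ev lam))) * g.cutSup h ≤ c →
      K.l2 n U lam h ≤ c

/-- with the EQUALITY relation the relative L² co-reading IS the landed `L2Reads`. [cite: Balaban1985BackgroundPropagators, (3.46) p.398, bookkeeping] -/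
theorem l2ReadsRel_eq_iff {u v : Type} [Fintype u] [Fintype v] [DecidableEq g.Site] (K : B9.KernelFamily g B) (n : Fin 6)
    (U : B.Cfg) (bu : u → g.Site) (bv : v → g.Site) (ev : g.Loc → v → ℝ) (T : (v → ℝ) →ₗ[ℝ] (u → ℝ)) :
    L2ReadsRel (R := R) (H := H) K n U Eq bu bv ev T ↔ L2Reads (R := R) (H := H) K n U bu bv ev T := by
  have hsum : ∀ (y : g.Site) (f : u → ℝ),
      ∑ y'' ∈ Finset.univ.filter (fun y'' => y'' = y), bl2 (g := toB6 g R H) bu y'' f = bl2 (g := toB6 g R H) bu y f := by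
    intro y f
    rw [Finset.filter_eq', if_pos (Finset.mem_univ y), Finset.sum_singleton]
  constructor
  · intro h
    exact { off := h.off
            l2bound := fun lam y' hs => h.l2bound lam y' y' hs rfl
            l2norm_nonneg := h.l2norm_nonneg
            cutSup_nonneg := h.cutSup_nonneg
            obs := fun lam hh y c hc hcut hb => h.obs lam hh y c hc hcut (by rw [hsum]; exact hb) }
  · intro h
    exact { off := h.off
            l2bound := fun lam y' y'' hs hy => by rw [hy]; exact h.l2bound lam y' hs
            l2norm_nonneg := h.l2norm_nonneg
            cutSup_nonneg := h.cutSup_nonneg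
            obs := fun lam hh y c hc hcut hb => h.obs lam hh y c hc hcut (by rw [← hsum]; exact hb) }

variable {X Y PX PY : Type}

/-- ★ **CO-READING OF THE HÖLDER QUANTITY `K.h1` ((3.43)) BY TWO MODEL OPERATORS THROUGH THE PROBES, RELATIVE TO A BLOCK EQUIVALENCE
`Rel`** (the repaired form of `B9RWSums343Holder.H1Reads`; `Rel := Eq` recovers it).  Print, (3.43) p. 398 + (3.40) p. 397.  Typed:
`off`∕`offY` — supp λ ⊂ Δ(y′) ⇒ the evaluations on X and Y vanish at the model points whose site is not in the class of y′; `bound`∕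
`boundY` — |ev λ|, |evY λ| ≦ |λ|; `obs` — for ζ ∈ C₀^∞(Δ̃(y)): h1(U, λ, β, ζ) ≦ c·(‖ζ‖^ξ_β + |ζ|) whenever every probe anchored IN THE
CLASS OF y is ≦ c on T_L(ev λ) and on T_R(evY λ).  A HYPOTHESIS SCHEMA; nothing asserted.
[cite: Balaban1985BackgroundPropagators, (3.43) p.398 + (3.40) p.397] -/
structure H1ReadsRel (K : B9.KernelFamily g B) (U : B.Cfg) (𝔭 : HolderProbes g B X Y PX PY)
    (Rel : g.Site → g.Site → Prop) (blk : X → g.Site) (blkY : Y → g.Site) (ev : g.Loc → X → ℝ) (evY : g.Loc → Y → ℝ)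
    (TL : (X → ℝ) →ₗ[ℝ] (Y → ℝ)) (TR : (Y → ℝ) →ₗ[ℝ] (X → ℝ)) : Prop where
  off : ∀ (lam : g.Loc) (y' : g.Site), g.suppIn lam y' → ∀ x, ¬ Rel (blk x) y' → ev lam x = 0
  bound : ∀ (lam : g.Loc) (x : X), |ev lam x| ≤ g.supNorm lam
  offY : ∀ (lam : g.Loc) (y' : g.Site), g.suppIn lam y' → ∀ v, ¬ Rel (blkY v) y' → evY lam v = 0
  boundY : ∀ (lam : g.Loc) (v : Y), |evY lam v| ≤ g.supNorm lam
  norm_nonneg : ∀ lam : g.Loc, 0 ≤ g.supNorm lam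
  cutH_nonneg : ∀ (β : ℝ) (ζ : g.Cut), 0 ≤ g.cutH β ζ
  obs : ∀ (lam : g.Loc) (β : ℝ) (ζ : g.Cut) (y : g.Site) (c : ℝ), 0 ≤ c → g.cutInT ζ y →
    (∀ p : PY, Rel (𝔭.blkPY p) y → |𝔭.ΦY U β (TL (ev lam)) p| ≤ c) →
    (∀ p : PX, Rel (𝔭.blkPX p) y → |𝔭.ΦX U β (TR (evY lam)) p| ≤ c) →
    K.h1 U lam β ζ ≤ c * g.cutH β ζ

omit [Fintype g.Site] in
/-- with the EQUALITY relation the relative Hölder co-reading IS the landed `H1Reads`. [cite: Balaban1985BackgroundPropagators, (3.43) p.398, bookkeeping] -/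
theorem h1ReadsRel_eq_iff (K : B9.KernelFamily g B) (U : B.Cfg) (𝔭 : HolderProbes g B X Y PX PY) (blk : X → g.Site)
    (blkY : Y → g.Site) (ev : g.Loc → X → ℝ) (evY : g.Loc → Y → ℝ) (TL : (X → ℝ) →ₗ[ℝ] (Y → ℝ))
    (TR : (Y → ℝ) →ₗ[ℝ] (X → ℝ)) :
    H1ReadsRel K U 𝔭 Eq blk blkY ev evY TL TR ↔ H1Reads K U 𝔭 blk blkY ev evY TL TR :=
  ⟨fun h => ⟨h.off, h.bound, h.offY, h.boundY, h.norm_nonneg, h.cutH_nonneg, h.obs⟩,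
    fun h => ⟨h.off, h.bound, h.offY, h.boundY, h.norm_nonneg, h.cutH_nonneg, h.obs⟩⟩

/-- ★ **CO-READING OF THE INPUT-HÖLDER QUANTITIES `K.e4` ((3.44)) AND `K.h2` ((3.45)) BY THE MODEL OPERATOR A = ∇_UG∇\*_U, RELATIVE TO A
BLOCK EQUIVALENCE `Rel`** (the repaired form of `B9RWSums344Input.InputReads`; `Rel := Eq` recovers it).  The input side is read through
the block-norm LETTER `bH ε` (its own localisation `IsLoc`, unchanged); the observed side is re-sited: `obs4` — e4(U, λ, y) ≦ c whenever
|A(evY λ)| ≦ c at every model point whose site is in the class of y; `obs5` — h2(U, λ, β, ζ) ≦ c·(‖ζ‖^ξ_β + |ζ|) whenever every probe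
anchored in the class of y is ≦ c on A(evY λ).  A HYPOTHESIS SCHEMA; nothing asserted.
[cite: Balaban1985BackgroundPropagators, (3.44)–(3.45) p.398 + (3.40) p.397] -/
structure InputReadsRel [Fintype Y] (K : B9.KernelFamily g B) (U : B.Cfg) (𝔭 : HolderProbes g B X Y PX PY)
    (bH : ℝ → BlockNorm (toB6 g R H) (Y → ℝ)) (Rel : g.Site → g.Site → Prop) (blkY : Y → g.Site)
    (evY : g.Loc → Y → ℝ) (A : (Y → ℝ) →ₗ[ℝ] (Y → ℝ)) : Prop where
  isLoc : ∀ (ε : ℝ) (lam : g.Loc) (y' : g.Site), g.suppInT lam y' → (bH ε).IsLoc y' (evY lam)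
  loc_le : ∀ (ε : ℝ) (lam : g.Loc) (y' : g.Site), g.suppInT lam y' →
    (bH ε).loc y' (evY lam) ≤ g.holder ε lam + g.supNorm lam
  hs_nonneg : ∀ (ε : ℝ) (lam : g.Loc), 0 ≤ g.holder ε lam + g.supNorm lam
  cutH_nonneg : ∀ (β : ℝ) (ζ : g.Cut), 0 ≤ g.cutH β ζ
  obs4 : ∀ (lam : g.Loc) (y : g.Site) (c : ℝ), 0 ≤ c → (∀ v : Y, Rel (blkY v) y → |A (evY lam) v| ≤ c) → K.e4 U lam y ≤ c
  obs5 : ∀ (lam : g.Loc) (β : ℝ) (ζ : g.Cut) (y : g.Site) (c : ℝ), 0 ≤ c → g.cutInT ζ y →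
    (∀ p : PY, Rel (𝔭.blkPY p) y → |𝔭.ΦY U β (A (evY lam)) p| ≤ c) → K.h2 U lam β ζ ≤ c * g.cutH β ζ

/-- with the EQUALITY relation the relative input co-reading IS the landed `InputReads`. [cite: Balaban1985BackgroundPropagators, (3.44)–(3.45) p.398, bookkeeping] -/
theorem inputReadsRel_eq_iff [Fintype Y] [Fintype PY] (K : B9.KernelFamily g B) (U : B.Cfg) (𝔭 : HolderProbes g B X Y PX PY)
    (bH : ℝ → BlockNorm (toB6 g R H) (Y → ℝ)) (blkY : Y → g.Site) (evY : g.Loc → Y → ℝ) (A : (Y → ℝ) →ₗ[ℝ] (Y → ℝ)) :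
    InputReadsRel K U 𝔭 bH Eq blkY evY A ↔ InputReads K U 𝔭 bH blkY evY A :=
  ⟨fun h => ⟨h.isLoc, h.loc_le, h.hs_nonneg, h.cutH_nonneg, h.obs4, h.obs5⟩,
    fun h => ⟨h.isLoc, h.loc_le, h.hs_nonneg, h.cutH_nonneg, h.obs4, h.obs5⟩⟩

end Schemas

/-! ## §3 The engines: the member lines AS TYPED, with the class multiplicity in the constant -/

section Engines

variable {g : B9.Geometry} [Fintype g.Site] [DecidableEq g.Site] {R : ℝ} {H : Prop} {B : B9.Backgrounds}

/-- ★ **AN L² BLOCK BOUND OF THE PRINTED SHAPE ⇒ THE n-TH (3.46) LINE AS TYPED, RELATIVE READING** (the repaired `l2line_of_blockBd`):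
if T has the block bound B′·pref6(Lʲη)_n·e^{−δ′d(y,y′)} between the fibres of `bv` (input) and `bu` (output), B′ ≧ 0, `K.l2 n` is co-read
by T relative to `Rel`, the classes have at most m members and Lʲη, d are saturated on classes, then ∀ λ h y y′ (supp h ⊂ Δ(y), supp λ ⊂
Δ(y′)): K.l2 n U λ h ≦ (m·m·B′)·pref6(Lʲη)_n·|h|·e^{−δ′d(y,y′)}·‖λ‖. [cite: Balaban1985BackgroundPropagators, (3.46) p.398; Balaban1984PropagatorsII, (2.51)–(2.52) p.232] -/
theorem l2line_of_blockBd_rel {u v : Type} [Fintype u] [Fintype v] {K : B9.KernelFamily g B} {n : Fin 6} {U : B.Cfg}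
    {Rel : g.Site → g.Site → Prop} [DecidableRel Rel] {bu : u → g.Site} {bv : v → g.Site} {ev : g.Loc → v → ℝ}
    {T : (v → ℝ) →ₗ[ℝ] (u → ℝ)} (hR : L2ReadsRel (R := R) (H := H) K n U Rel bu bv ev T)
    (hRlen : ∀ a a', Rel a a' → g.len a = g.len a') (hRd₁ : ∀ a a' b, Rel a a' → g.dist a b = g.dist a' b)
    (hRd₂ : ∀ a b b', Rel b b' → g.dist a b = g.dist a b')
    {m : ℕ} (hmult : ∀ y' : g.Site, (Finset.univ.filter (fun y'' => Rel y'' y')).card ≤ m)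
    {B' δ' : ℝ} (hB : 0 ≤ B') (hlen : ∀ y : g.Site, 0 ≤ g.len y)
    (hT : BlockBd (g := toB6 g R H) bv bu T
      (fun (y y' : g.Site) => B' * B9.pref6 (g.len y) n * Real.exp (-(δ' * g.dist y y')))) :
    ∀ (lam : g.Loc) (h : g.Cut) (y y' : g.Site), g.cutIn h y → g.suppIn lam y' →
      K.l2 n U lam h ≤ (m * m * B') * B9.pref6 (g.len y) n * g.cutSup h * Real.exp (-(δ' * g.dist y y')) * g.l2Norm lam := by
  intro lam h y y' hcut hsupp
  have hK' : ∀ a b : g.Site, 0 ≤ B' * B9.pref6 (g.len a) n * Real.exp (-(δ' * g.dist a b)) := fun a b =>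
    mul_nonneg (mul_nonneg hB (B9FromB6.pref6_nonneg (hlen a) n)) (Real.exp_nonneg _)
  have hsat₁ : ∀ a a' b : g.Site, Rel a a' →
      B' * B9.pref6 (g.len a) n * Real.exp (-(δ' * g.dist a b)) = B' * B9.pref6 (g.len a') n * Real.exp (-(δ' * g.dist a' b)) :=
    fun a a' b hr => by rw [hRlen a a' hr, hRd₁ a a' b hr]
  have hsat₂ : ∀ a b b' : g.Site, Rel b b' →
      B' * B9.pref6 (g.len a) n * Real.exp (-(δ' * g.dist a b)) = B' * B9.pref6 (g.len a) n * Real.exp (-(δ' * g.dist a b')) :=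
    fun a b b' hr => by rw [hRd₂ a b b' hr]
  have hsum := bl2_classSum_le_of_blockBd_rel (R := R) (H := H) hK' hsat₁ hsat₂ hmult hT (hR.l2norm_nonneg lam)
    (fun y'' hy'' => hR.l2bound lam y' y'' hsupp hy'') (hR.off lam y' hsupp) y
  have hc : 0 ≤ (m * m * B') * B9.pref6 (g.len y) n * g.cutSup h * Real.exp (-(δ' * g.dist y y')) * g.l2Norm lam :=
    mul_nonneg (mul_nonneg (mul_nonneg (mul_nonneg (mul_nonneg (mul_nonneg (Nat.cast_nonneg m) (Nat.cast_nonneg m)) hB)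
      (B9FromB6.pref6_nonneg (hlen y) n)) (hR.cutSup_nonneg h)) (Real.exp_nonneg _)) (hR.l2norm_nonneg lam)
  refine hR.obs lam h y _ hc hcut ?_
  calc (∑ y'' ∈ Finset.univ.filter (fun y'' => Rel y'' y), bl2 (g := toB6 g R H) bu y'' (T (ev lam))) * g.cutSup h
      ≤ (m * (m * (B' * B9.pref6 (g.len y) n * Real.exp (-(δ' * g.dist y y')))) * g.l2Norm lam) * g.cutSup h :=
        mul_le_mul_of_nonneg_right hsum (hR.cutSup_nonneg h)
    _ = (m * m * B') * B9.pref6 (g.len y) n * g.cutSup h * Real.exp (-(δ' * g.dist y y')) * g.l2Norm lam := by ring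

variable {X Y PX PY : Type}

/-- ★ **TWO PROBE MAJORANTS OF THE PRINTED SHAPE ⇒ THE (3.43) LINE AS TYPED, RELATIVE READING** (the repaired `line343_of_hasMajorantHom`):
if for every 0 ≦ β < 1 the model operators read through the probes, Φ^Y_β(U)∘T_L and Φ^X_β(U)∘T_R, have the two-space sup majorants
B(β)(Lʲη)^{1−β}e^{−δ₀d(y,y′)} with B(β) ≧ 0, `K.h1` is co-read by (T_L, T_R) through the probes relative to `Rel`, the classes have at most m
members and Lʲη, d are saturated on classes, then ∀ β λ ζ y y′ (0 ≦ β < 1, ζ ∈ C₀^∞(Δ̃(y)), supp λ ⊂ Δ(y′)): h1(U, λ, β, ζ) ≦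
(m·B(β))(Lʲη)^{1−β}(‖ζ‖^ξ_β + |ζ|)e^{−δ₀d(y,y′)}|λ|. [cite: Balaban1985BackgroundPropagators, (3.43) p.398; Balaban1984PropagatorsII, (2.51)–(2.52) p.232] -/
theorem line343_of_hasMajorantHom_rel {K : B9.KernelFamily g B} {U : B.Cfg} {𝔭 : HolderProbes g B X Y PX PY}
    {Rel : g.Site → g.Site → Prop} [DecidableRel Rel] {blk : X → g.Site} {blkY : Y → g.Site} {ev : g.Loc → X → ℝ}
    {evY : g.Loc → Y → ℝ} {TL : (X → ℝ) →ₗ[ℝ] (Y → ℝ)} {TR : (Y → ℝ) →ₗ[ℝ] (X → ℝ)}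
    (hR : H1ReadsRel K U 𝔭 Rel blk blkY ev evY TL TR)
    (hRlen : ∀ a a', Rel a a' → g.len a = g.len a') (hRd₁ : ∀ a a' b, Rel a a' → g.dist a b = g.dist a' b)
    (hRd₂ : ∀ a b b', Rel b b' → g.dist a b = g.dist a b')
    {m : ℕ} (hmult : ∀ y' : g.Site, (Finset.univ.filter (fun y'' => Rel y'' y')).card ≤ m)
    {Bβ : ℝ → ℝ} {δ₀ : ℝ} (hB : ∀ β, 0 ≤ β → β < 1 → 0 ≤ Bβ β) (hlen : ∀ y : g.Site, 0 ≤ g.len y)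
    (hL : ∀ β, 0 ≤ β → β < 1 → HasMajorantHom (g := toB6 g R H) blk 𝔭.blkPY (𝔭.ΦY U β ∘ₗ TL)
      (fun (a b : g.Site) => Bβ β * g.len a ^ (1 - β) * Real.exp (-(δ₀ * g.dist a b))))
    (hRt : ∀ β, 0 ≤ β → β < 1 → HasMajorantHom (g := toB6 g R H) blkY 𝔭.blkPX (𝔭.ΦX U β ∘ₗ TR)
      (fun (a b : g.Site) => Bβ β * g.len a ^ (1 - β) * Real.exp (-(δ₀ * g.dist a b)))) :
    ∀ (β : ℝ) (lam : g.Loc) (ζ : g.Cut) (y y' : g.Site), 0 ≤ β → β < 1 → g.cutInT ζ y → g.suppIn lam y' →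
      K.h1 U lam β ζ ≤ (m * Bβ β) * (g.len y) ^ (1 - β) * g.cutH β ζ * Real.exp (-(δ₀ * g.dist y y')) *
        g.supNorm lam := by
  intro β lam ζ y y' hβ0 hβ1 hζ hs
  have hK' : ∀ a b : g.Site, 0 ≤ Bβ β * g.len a ^ (1 - β) * Real.exp (-(δ₀ * g.dist a b)) := fun a b =>
    mul_nonneg (mul_nonneg (hB β hβ0 hβ1) (Real.rpow_nonneg (hlen a) _)) (Real.exp_nonneg _)
  have hsat₁ : ∀ a a' b : g.Site, Rel a a' →
      Bβ β * g.len a ^ (1 - β) * Real.exp (-(δ₀ * g.dist a b)) = Bβ β * g.len a' ^ (1 - β) * Real.exp (-(δ₀ * g.dist a' b)) :=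
    fun a a' b hr => by rw [hRlen a a' hr, hRd₁ a a' b hr]
  have hsat₂ : ∀ a b b' : g.Site, Rel b b' →
      Bβ β * g.len a ^ (1 - β) * Real.exp (-(δ₀ * g.dist a b)) = Bβ β * g.len a ^ (1 - β) * Real.exp (-(δ₀ * g.dist a b')) :=
    fun a b b' hr => by rw [hRd₂ a b b' hr]
  have hN := hR.norm_nonneg lam
  have hc : 0 ≤ m * (Bβ β * g.len y ^ (1 - β) * Real.exp (-(δ₀ * g.dist y y'))) * g.supNorm lam :=
    mul_nonneg (mul_nonneg (Nat.cast_nonneg m) (hK' y y')) hN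
  have hobs := hR.obs lam β ζ y _ hc hζ
    (fun p hp => abs_le_of_hasMajorantHom_rel (R := R) (H := H) hK' hsat₁ hsat₂ hmult (hL β hβ0 hβ1) hN
      (hR.bound lam) (hR.off lam y' hs) hp)
    (fun p hp => abs_le_of_hasMajorantHom_rel (R := R) (H := H) hK' hsat₁ hsat₂ hmult (hRt β hβ0 hβ1) hN
      (hR.boundY lam) (hR.offY lam y' hs) hp)
  exact hobs.trans (le_of_eq (by ring))

omit [DecidableEq g.Site] in
/-- ★ **TWO BLOCK-NORM MAJORANTS OF THE PRINTED SHAPES ⇒ THE (3.44) AND (3.45) LINES AS TYPED, RELATIVE READING** (the repaired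
`lines3445_of_hasMaj`; the constants are UNCHANGED — the input block norm `bH ε` localises by its own letter, and the sharp-block sup size
read at a model point of the class of y is saturated there): if for 0 < ε ≦ 1 the operator A read from `bH ε` into the sharp blocks of Y
has the majorant B′(ε)e^{−δ₀d(y,y′)}, and for 0 < ε ≦ 1, 0 ≦ β < 1 the operator Φ^Y_β∘A read from `bH (β+ε)` into the probe lattice has the
majorant B′(ε,β)(Lʲη)^{−β}e^{−δ₀d(y,y′)}, then the (3.44) and (3.45) lines hold for K at U.
[cite: Balaban1985BackgroundPropagators, (3.44)–(3.45) p.398] -/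
theorem lines3445_of_hasMaj_rel [Fintype Y] [Fintype PY] {K : B9.KernelFamily g B} {U : B.Cfg}
    {𝔭 : HolderProbes g B X Y PX PY} {bH : ℝ → BlockNorm (toB6 g R H) (Y → ℝ)} {Rel : g.Site → g.Site → Prop}
    {blkY : Y → g.Site} {evY : g.Loc → Y → ℝ} {A : (Y → ℝ) →ₗ[ℝ] (Y → ℝ)} (hR : InputReadsRel K U 𝔭 bH Rel blkY evY A)
    (hRlen : ∀ a a', Rel a a' → g.len a = g.len a') (hRd₁ : ∀ a a' b, Rel a a' → g.dist a b = g.dist a' b)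
    {Bε : ℝ → ℝ} {Bεβ : ℝ → ℝ → ℝ} {δ₀ : ℝ}
    (hBε : ∀ ε, 0 < ε → ε ≤ 1 → 0 ≤ Bε ε) (hBεβ : ∀ ε β, 0 < ε → ε ≤ 1 → 0 ≤ β → β < 1 → 0 ≤ Bεβ ε β)
    (hlen : ∀ y : g.Site, 0 < g.len y)
    (h44 : ∀ ε, 0 < ε → ε ≤ 1 → HasMaj (bH ε) (BlockNorm.ofBlocks (toB6 g R H) blkY) A
      (fun (a b : g.Site) => Bε ε * Real.exp (-(δ₀ * g.dist a b))))
    (h45 : ∀ ε β, 0 < ε → ε ≤ 1 → 0 ≤ β → β < 1 →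
      HasMaj (bH (β + ε)) (BlockNorm.ofBlocks (toB6 g R H) 𝔭.blkPY) (𝔭.ΦY U β ∘ₗ A)
        (fun (a b : g.Site) => Bεβ ε β * g.len a ^ (-β) * Real.exp (-(δ₀ * g.dist a b)))) :
    (∀ (ε : ℝ) (lam : g.Loc) (y y' : g.Site), 0 < ε → ε ≤ 1 → g.suppInT lam y' →
        K.e4 U lam y ≤ Bε ε * Real.exp (-(δ₀ * g.dist y y')) * (g.holder ε lam + g.supNorm lam)) ∧
      (∀ (ε β : ℝ) (lam : g.Loc) (ζ : g.Cut) (y y' : g.Site), 0 < ε → ε ≤ 1 → 0 ≤ β → β < 1 →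
        g.cutInT ζ y → g.suppInT lam y' →
        K.h2 U lam β ζ ≤ Bεβ ε β * (g.len y) ^ (-β) * g.cutH β ζ * Real.exp (-(δ₀ * g.dist y y')) *
          (g.holder (β + ε) lam + g.supNorm lam)) := by
  refine ⟨fun ε lam y y' hε0 hε1 hs => ?_, fun ε β lam ζ y y' hε0 hε1 hβ0 hβ1 hζ hs => ?_⟩
  · have hK : 0 ≤ Bε ε * Real.exp (-(δ₀ * g.dist y y')) := mul_nonneg (hBε ε hε0 hε1) (Real.exp_nonneg _)
    have hc : 0 ≤ Bε ε * Real.exp (-(δ₀ * g.dist y y')) * (g.holder ε lam + g.supNorm lam) :=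
      mul_nonneg hK (hR.hs_nonneg ε lam)
    refine hR.obs4 lam y _ hc fun v hv => ?_
    have hb : (BlockNorm.ofBlocks (toB6 g R H) blkY).loc (blkY v) (A (evY lam)) ≤
        Bε ε * Real.exp (-(δ₀ * g.dist (blkY v) y')) * (bH ε).loc y' (evY lam) :=
      h44 ε hε0 hε1 y' (evY lam) (hR.isLoc ε lam y' hs) (blkY v)
    have hpt := abs_apply_le_ofBlocks_loc (G := toB6 g R H) blkY (blkY v) (A (evY lam)) v rfl
    rw [hRd₁ _ _ y' hv] at hb
    exact hpt.trans (hb.trans (mul_le_mul_of_nonneg_left (hR.loc_le ε lam y' hs) hK))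
  · have hK : 0 ≤ Bεβ ε β * g.len y ^ (-β) * Real.exp (-(δ₀ * g.dist y y')) :=
      mul_nonneg (mul_nonneg (hBεβ ε β hε0 hε1 hβ0 hβ1) (Real.rpow_nonneg (hlen y).le _)) (Real.exp_nonneg _)
    have hc : 0 ≤ Bεβ ε β * g.len y ^ (-β) * Real.exp (-(δ₀ * g.dist y y')) * (g.holder (β + ε) lam + g.supNorm lam) :=
      mul_nonneg hK (hR.hs_nonneg (β + ε) lam)
    have hobs := hR.obs5 lam β ζ y _ hc hζ fun p hp => by
      have hb : (BlockNorm.ofBlocks (toB6 g R H) 𝔭.blkPY).loc (𝔭.blkPY p) ((𝔭.ΦY U β ∘ₗ A) (evY lam)) ≤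
          Bεβ ε β * g.len (𝔭.blkPY p) ^ (-β) * Real.exp (-(δ₀ * g.dist (𝔭.blkPY p) y')) *
            (bH (β + ε)).loc y' (evY lam) :=
        h45 ε β hε0 hε1 hβ0 hβ1 y' (evY lam) (hR.isLoc (β + ε) lam y' hs) (𝔭.blkPY p)
      have hpt := abs_apply_le_ofBlocks_loc (G := toB6 g R H) 𝔭.blkPY (𝔭.blkPY p) ((𝔭.ΦY U β ∘ₗ A) (evY lam)) p rfl
      rw [LinearMap.comp_apply] at hpt
      rw [hRlen _ _ hp, hRd₁ _ _ y' hp] at hb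
      exact hpt.trans (hb.trans (mul_le_mul_of_nonneg_left (hR.loc_le (β + ε) lam y' hs) hK))
    exact hobs.trans (le_of_eq (by ring))

end Engines

end Literature.MathematicalPhysics.QuantumFieldTheory.Balaban1983to89.B9RWSumsReadsRel

end
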